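/-
Copyright (c) 2026 the pub-hodgecm-mathlib formalisation cell (harness21).  Prover seat hodgecm-mathlib-K2E5-p16 (g7), Track B «K2-LIT»,
#184♮ = hLiu418 = `stmt-HodgeConjecture-24832`; S2-asm road (γ) packaging, FRAME BLOCK FILE 3 (K2Liu-p05 (g6) 14:53:23Z split «MINE = frames + hfr∕hα∕hβ»):
THE SIGN LETTER of the reading points — the sign-frame components of `pt v = archPiEquivCM⁻¹ (w ↦ fr_w (v w))` are `kV (α_σ, β_σ)` with
`(det α_σ, det β_σ) = (1, det v_{w(σ)})` if `0 < deltaIm σ` and `(det v_{w(σ)}, 1)` otherwise.  THEOREMS ONLY (no `def`, no `instance`, no notation, no `sorry`).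
-/
import Summits.HodgeConjecture.HodgeConjecture.Theorems.K2LiuArchReadingFrame                -- ★ FILE 2: the reading frames (matrix formula), `archAt_archPiEquivCM_symm`
import Literature.NumberTheory.Weil1964.ArchUnitaryWeilHalfCompactBlock                     -- ★ `det_of_archUFormPi_eq_kV_of_sign_separated`
import Literature.NumberTheory.GelbartRogawski1991.DoubledWeilRepresentationArchVacuumUndoubling  -- ★ `signVec_doubled_inl∕_inr`
import Literature.NumberTheory.Weil1964.ArchFollandTorusAdelic                              -- ★ `realPlaceMap_eq_embedding_of_isReal`
import HarnessLib

/-!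
# Crux `HLiu418`, Road (γ) frame block FILE 3: the sign letter of the reading points

Cell `hodgecm-mathlib`, crux item hLiu418 = `stmt-HodgeConjecture-24832` (helper lane `--supports`, count-neutral).

★ FILE 1 §3 (`frameInv_kappa_frame`) says the frame image `T_w⁻¹ κ(1,u) T_w` of a compact-chart point is SIGN-SORTED: identity-like on the slot
`{inl k : 0 < t_k} ∪ {inr k : t_k < 0}`, `(d_j∕d_i)·u_{ij}` on its complement, `0` across.  The doubled sign vector at the real place `σ` under `w = w(σ)` is
`x(e₂ inl k) = t_k∕c_σ`, `x(e₂ inr k) = −t_k∕c_σ` with `c_σ = deltaIm σ = Im σ_w(δ)` (★ `signVec_doubled_inl∕inr`, ★ `realPlaceMap_eq_embedding_of_isReal`), so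
`0 < x_i ⇔ (i ∈ slot ⇔ 0 < c_σ)`: the place component is SIGN-SEPARATED and ★ `det_of_archUFormPi_eq_kV_of_sign_separated` applies.
* §1 (ring level, `t`, `u` abstract) the sorted matrix `B(t; 1, u)`: **`sorted_apply`** (one closed form: `1_{pq}` on the slot, `(d_q∕d_p)·u` on the co-slot, `0` across), the two
  sub-matrices∕determinants `submatrix_sorted_eq_one`, `det_submatrix_sorted_eq_det`;
* §2 the sign dictionary at `σ`: `re_embedding_cmPlaceOver_eq`, `pos_signVec_e₂_iff` (`0 < x(e₂ p) ⇔ (p ∈ slot ⇔ 0 < c_σ)`);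
* §3 **`exists_kV_readingPoint`** — THE LETTER: for reading frames with the ★ FILE 2 matrix formula, every `v : w ↦ U(n)` and every real `σ`:
  `∃ k, archUFormPi_𝔻 (archPiEquivCM⁻¹ (w ↦ fr_w (v w))) σ = kV k ∧ det k.1 = (0 < c_σ ? 1 : det v_{w(σ)}) ∧ det k.2 = (0 < c_σ ? det v_{w(σ)} : 1)`.
With ★ `K2LiuArchSWAnchorCharacter.archSWValue_archFrameGauss_reading_of_det_snd∕_fst` this is (hanc) of ★ `K2LiuArchSWSpanningInstance.archSWRegionSpanning_of_systems`'s `hsys`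
(K2Liu-p05), read per sign of `deltaIm σ` (K2Liu-ref1 14:36:51Z ∕ 14:54:17Z pins).
References: [Shimura1997, §6.5]; [KonnoKonno2007, §3.1 (3.1)]; [Folland1989, §4.2 Prop. (4.39)]; [HarrisKudlaSweet1996, §1 (1.9)].
HONEST LABEL: HC_CM is proved only modulo the 7 printed citations (2 remaining named inputs: hLiu418 = stmt-HodgeConjecture-24832,
h413 = stmt-HodgeConjecture-24833) until rung 0 closes; count-neutral helper, closes no socket.
-/

set_option autoImplicit false
set_option linter.dupNamespace false

noncomputable section

namespace Summit.HodgeConjecture.HodgeConjecture.Cruxes.HLiu418.K2LiuArchReadingFrameSign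

open Matrix Complex NumberField NumberField.InfinitePlace
open scoped MatrixGroups ComplexConjugate Classical

/-! ## §1 Ring level: the sorted matrix `B(t; 1, u)` -/

section Sorted

variable {n : ℕ} (t : Fin n → ℝ) (ht : ∀ k, t k ≠ 0) (u : Matrix (Fin n) (Fin n) ℂ)

omit ht in
/-- the scaling ratio on the diagonal is `1`: `(d_i∕d_i)·1_{ii} = 1_{ij}`-bookkeeping. [folklore] -/
theorem ratio_mul_one_apply (ht : ∀ k, t k ≠ 0) (i j : Fin n) :
    ((Real.sqrt (|t j| / 2) / Real.sqrt (|t i| / 2) : ℝ) : ℂ) * (1 : Matrix (Fin n) (Fin n) ℂ) i j = (1 : Matrix (Fin n) (Fin n) ℂ) i j := by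
  by_cases hij : i = j
  · subst hij
    have hd : Real.sqrt (|t i| / 2) ≠ 0 := (Real.sqrt_pos.2 (by have := abs_pos.2 (ht i); positivity)).ne'
    rw [div_self hd, ofReal_one, one_mul]
  · rw [Matrix.one_apply_ne hij, mul_zero]

include ht in
/-- **THE SORTED MATRIX, ENTRY BY ENTRY**: `B(t; 1, u)_{pq}` is `1_{pq}` when `p, q` both lie in the slot `{inl k : 0 < t_k} ∪ {inr k : t_k < 0}`, `(d_q∕d_p)·u_{p̄q̄}` (underlying
indices) when both lie off it, and `0` across. [cite: Shimura1997, §6.5] [cite: KonnoKonno2007, §3.1 (3.1)] -/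
theorem sorted_apply (p q : Fin n ⊕ Fin n) :
    (fromBlocks
        (Matrix.of fun i j => ((Real.sqrt (|t j| / 2) / Real.sqrt (|t i| / 2) : ℝ) : ℂ) *
          (if 0 < t i then (if 0 < t j then (1 : Matrix (Fin n) (Fin n) ℂ) i j else 0) else (if 0 < t j then 0 else u i j)))
        (Matrix.of fun i j => ((Real.sqrt (|t j| / 2) / Real.sqrt (|t i| / 2) : ℝ) : ℂ) *
          (if 0 < t i then (if 0 < t j then 0 else (1 : Matrix (Fin n) (Fin n) ℂ) i j) else (if 0 < t j then u i j else 0)))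
        (Matrix.of fun i j => ((Real.sqrt (|t j| / 2) / Real.sqrt (|t i| / 2) : ℝ) : ℂ) *
          (if 0 < t i then (if 0 < t j then 0 else u i j) else (if 0 < t j then (1 : Matrix (Fin n) (Fin n) ℂ) i j else 0)))
        (Matrix.of fun i j => ((Real.sqrt (|t j| / 2) / Real.sqrt (|t i| / 2) : ℝ) : ℂ) *
          (if 0 < t i then (if 0 < t j then u i j else 0) else (if 0 < t j then 0 else (1 : Matrix (Fin n) (Fin n) ℂ) i j))) :
        Matrix (Fin n ⊕ Fin n) (Fin n ⊕ Fin n) ℂ) p q =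
      if (Sum.elim (fun k => 0 < t k) (fun k => ¬0 < t k) p ↔ Sum.elim (fun k => 0 < t k) (fun k => ¬0 < t k) q) then
        (if Sum.elim (fun k => 0 < t k) (fun k => ¬0 < t k) p then (1 : Matrix (Fin n ⊕ Fin n) (Fin n ⊕ Fin n) ℂ) p q
          else ((Real.sqrt (|t (Sum.elim id id q)| / 2) / Real.sqrt (|t (Sum.elim id id p)| / 2) : ℝ) : ℂ) * u (Sum.elim id id p) (Sum.elim id id q))
      else 0 := by
  rcases p with i | i <;> rcases q with j | j <;>
    simp only [Sum.elim_inl, Sum.elim_inr, fromBlocks_apply₁₁, fromBlocks_apply₁₂, fromBlocks_apply₂₁, fromBlocks_apply₂₂, Matrix.of_apply, id]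
  · -- inl, inl
    by_cases hi : 0 < t i <;> by_cases hj : 0 < t j
    · rw [if_pos hi, if_pos hj, if_pos (iff_of_true hi hj), if_pos hi, ratio_mul_one_apply t ht, Matrix.one_apply, Matrix.one_apply]
      simp only [Sum.inl.injEq]
    · rw [if_pos hi, if_neg hj, if_neg (fun h => hj (h.1 hi)), mul_zero]
    · rw [if_neg hi, if_pos hj, if_neg (fun h => hi (h.2 hj)), mul_zero]
    · rw [if_neg hi, if_neg hj, if_pos (iff_of_false hi hj), if_neg hi]
  · -- inl, inr
    by_cases hi : 0 < t i <;> by_cases hj : 0 < t j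
    · rw [if_pos hi, if_pos hj, if_neg (fun h => (h.1 hi) hj), mul_zero]
    · have hij : i ≠ j := fun h => hj (h ▸ hi)
      rw [if_pos hi, if_neg hj, if_pos (iff_of_true hi hj), if_pos hi, Matrix.one_apply_ne hij, mul_zero, Matrix.one_apply_ne Sum.inl_ne_inr]
    · rw [if_neg hi, if_pos hj, if_pos (iff_of_false hi (not_not.2 hj)), if_neg hi]
    · rw [if_neg hi, if_neg hj, if_neg (fun h => hi (h.2 hj)), mul_zero]
  · -- inr, inl
    by_cases hi : 0 < t i <;> by_cases hj : 0 < t j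
    · rw [if_pos hi, if_pos hj, if_neg (fun h => (h.2 hj) hi), mul_zero]
    · rw [if_pos hi, if_neg hj, if_pos (iff_of_false (not_not.2 hi) hj), if_neg (not_not.2 hi)]
    · have hij : i ≠ j := fun h => hi (h ▸ hj)
      rw [if_neg hi, if_pos hj, if_pos (iff_of_true hi hj), if_pos hi, Matrix.one_apply_ne hij, mul_zero, Matrix.one_apply_ne Sum.inr_ne_inl]
    · rw [if_neg hi, if_neg hj, if_neg (fun h => hj (h.1 hi)), mul_zero]
  · -- inr, inr
    by_cases hi : 0 < t i <;> by_cases hj : 0 < t j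
    · rw [if_pos hi, if_pos hj, if_pos (iff_of_false (not_not.2 hi) (not_not.2 hj)), if_neg (not_not.2 hi)]
    · rw [if_pos hi, if_neg hj, if_neg (fun h => h.2 hj hi), mul_zero]
    · rw [if_neg hi, if_pos hj, if_neg (fun h => h.1 hi hj), mul_zero]
    · rw [if_neg hi, if_neg hj, if_pos (iff_of_true hi hj), if_pos hi, ratio_mul_one_apply t ht, Matrix.one_apply, Matrix.one_apply]
      simp only [Sum.inr.injEq]

include ht in
/-- **ON THE SLOT THE SORTED MATRIX IS THE IDENTITY**: along any injection `f` into the slot, `B(t; 1, u)|_f = 1`. [cite: Shimura1997, §6.5] -/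
theorem submatrix_sorted_eq_one {S : Type} [DecidableEq S] (f : S → Fin n ⊕ Fin n) (hf : Function.Injective f)
    (hS : ∀ s, Sum.elim (fun k => 0 < t k) (fun k => ¬0 < t k) (f s)) :
    (fromBlocks
        (Matrix.of fun i j => ((Real.sqrt (|t j| / 2) / Real.sqrt (|t i| / 2) : ℝ) : ℂ) *
          (if 0 < t i then (if 0 < t j then (1 : Matrix (Fin n) (Fin n) ℂ) i j else 0) else (if 0 < t j then 0 else u i j)))
        (Matrix.of fun i j => ((Real.sqrt (|t j| / 2) / Real.sqrt (|t i| / 2) : ℝ) : ℂ) *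
          (if 0 < t i then (if 0 < t j then 0 else (1 : Matrix (Fin n) (Fin n) ℂ) i j) else (if 0 < t j then u i j else 0)))
        (Matrix.of fun i j => ((Real.sqrt (|t j| / 2) / Real.sqrt (|t i| / 2) : ℝ) : ℂ) *
          (if 0 < t i then (if 0 < t j then 0 else u i j) else (if 0 < t j then (1 : Matrix (Fin n) (Fin n) ℂ) i j else 0)))
        (Matrix.of fun i j => ((Real.sqrt (|t j| / 2) / Real.sqrt (|t i| / 2) : ℝ) : ℂ) *
          (if 0 < t i then (if 0 < t j then u i j else 0) else (if 0 < t j then 0 else (1 : Matrix (Fin n) (Fin n) ℂ) i j))) :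
        Matrix (Fin n ⊕ Fin n) (Fin n ⊕ Fin n) ℂ).submatrix f f = 1 := by
  ext s s'
  rw [submatrix_apply, sorted_apply t ht u, if_pos (iff_of_true (hS s) (hS s')), if_pos (hS s)]
  by_cases h : s = s'
  · subst h; rw [Matrix.one_apply_eq, Matrix.one_apply_eq]
  · rw [Matrix.one_apply_ne (hf.ne h), Matrix.one_apply_ne h]

include ht in
/-- **OFF THE SLOT THE SORTED MATRIX IS `diag(d)⁻¹ · u · diag(d)` UP TO RELABELLING**: along any injection `f` onto the co-slot covering every underlying index,
`det (B(t; 1, u)|_f) = det u`. [cite: Shimura1997, §6.5] [cite: KonnoKonno2007, §3.1 (3.1)] -/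
theorem det_submatrix_sorted_eq_det {S : Type} [Fintype S] [DecidableEq S] (f : S → Fin n ⊕ Fin n) (hf : Function.Injective f)
    (hS : ∀ s, ¬ Sum.elim (fun k => 0 < t k) (fun k => ¬0 < t k) (f s)) (hsurj : ∀ k : Fin n, ∃ s, Sum.elim id id (f s) = k) :
    ((fromBlocks
        (Matrix.of fun i j => ((Real.sqrt (|t j| / 2) / Real.sqrt (|t i| / 2) : ℝ) : ℂ) *
          (if 0 < t i then (if 0 < t j then (1 : Matrix (Fin n) (Fin n) ℂ) i j else 0) else (if 0 < t j then 0 else u i j)))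
        (Matrix.of fun i j => ((Real.sqrt (|t j| / 2) / Real.sqrt (|t i| / 2) : ℝ) : ℂ) *
          (if 0 < t i then (if 0 < t j then 0 else (1 : Matrix (Fin n) (Fin n) ℂ) i j) else (if 0 < t j then u i j else 0)))
        (Matrix.of fun i j => ((Real.sqrt (|t j| / 2) / Real.sqrt (|t i| / 2) : ℝ) : ℂ) *
          (if 0 < t i then (if 0 < t j then 0 else u i j) else (if 0 < t j then (1 : Matrix (Fin n) (Fin n) ℂ) i j else 0)))
        (Matrix.of fun i j => ((Real.sqrt (|t j| / 2) / Real.sqrt (|t i| / 2) : ℝ) : ℂ) *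
          (if 0 < t i then (if 0 < t j then u i j else 0) else (if 0 < t j then 0 else (1 : Matrix (Fin n) (Fin n) ℂ) i j))) :
        Matrix (Fin n ⊕ Fin n) (Fin n ⊕ Fin n) ℂ).submatrix f f).det = u.det := by
  -- the relabelling `S ≃ Fin n` by underlying indices
  have hinj : Function.Injective fun s => Sum.elim id id (f s) := by
    intro s s' h
    apply hf
    have hs := hS s
    have hs' := hS s'
    simp only at h
    generalize hp : f s = p at h hs ⊢
    generalize hq : f s' = q at h hs' ⊢
    rcases p with i | i <;> rcases q with j | j <;> simp only [Sum.elim_inl, Sum.elim_inr, id] at h hs hs' <;> subst h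
    · rfl
    · exact absurd (not_not.1 hs') hs
    · exact absurd (not_not.1 hs) hs'
    · rfl
  let g : S ≃ Fin n := Equiv.ofBijective _ ⟨hinj, fun k => hsurj k⟩
  have hd : ∀ i, (Real.sqrt (|t i| / 2) : ℂ) ≠ 0 := fun i => ofReal_ne_zero.2 (Real.sqrt_pos.2 (by have := abs_pos.2 (ht i); positivity)).ne'
  -- `B|_f` is `diag(d)⁻¹ · u · diag(d)` relabelled by `g`
  have hsub : (fromBlocks
        (Matrix.of fun i j => ((Real.sqrt (|t j| / 2) / Real.sqrt (|t i| / 2) : ℝ) : ℂ) *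
          (if 0 < t i then (if 0 < t j then (1 : Matrix (Fin n) (Fin n) ℂ) i j else 0) else (if 0 < t j then 0 else u i j)))
        (Matrix.of fun i j => ((Real.sqrt (|t j| / 2) / Real.sqrt (|t i| / 2) : ℝ) : ℂ) *
          (if 0 < t i then (if 0 < t j then 0 else (1 : Matrix (Fin n) (Fin n) ℂ) i j) else (if 0 < t j then u i j else 0)))
        (Matrix.of fun i j => ((Real.sqrt (|t j| / 2) / Real.sqrt (|t i| / 2) : ℝ) : ℂ) *
          (if 0 < t i then (if 0 < t j then 0 else u i j) else (if 0 < t j then (1 : Matrix (Fin n) (Fin n) ℂ) i j else 0)))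
        (Matrix.of fun i j => ((Real.sqrt (|t j| / 2) / Real.sqrt (|t i| / 2) : ℝ) : ℂ) *
          (if 0 < t i then (if 0 < t j then u i j else 0) else (if 0 < t j then 0 else (1 : Matrix (Fin n) (Fin n) ℂ) i j))) :
        Matrix (Fin n ⊕ Fin n) (Fin n ⊕ Fin n) ℂ).submatrix f f =
      (diagonal (fun k => (Real.sqrt (|t k| / 2) : ℂ)⁻¹) * u * diagonal (fun k => (Real.sqrt (|t k| / 2) : ℂ))).submatrix g g := by
    ext s s'
    rw [submatrix_apply, sorted_apply t ht u, if_pos (iff_of_false (hS s) (hS s')), if_neg (hS s), submatrix_apply, mul_diagonal, diagonal_mul]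
    show _ = (Real.sqrt (|t (Sum.elim id id (f s))| / 2) : ℂ)⁻¹ * u (Sum.elim id id (f s)) (Sum.elim id id (f s')) * (Real.sqrt (|t (Sum.elim id id (f s'))| / 2) : ℂ)
    push_cast
    ring
  rw [hsub, det_submatrix_equiv_self, det_mul, det_mul, det_diagonal, det_diagonal, mul_comm, ← mul_assoc, ← Finset.prod_mul_distrib,
    Finset.prod_eq_one (fun i _ => mul_inv_cancel₀ (hd i)), one_mul]

end Sorted

/-! ## §2 The sign dictionary at a real place `σ` -/

section Signs

open Literature.NumberTheory.Automorphic Literature.NumberTheory.Automorphic.UnitaryGroup Literature.NumberTheory.Weil1964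
open Literature.NumberTheory.GelbartRogawski1991 Literature.NumberTheory.GelbartRogawski1991.UnitaryDualPair
open Literature.NumberTheory.GelbartRogawski1991.GRConstruction

variable (L : Type) [Field L] [NumberField L] [IsCMField L] {N M n : ℕ} (e : Fin N × Fin M ≃ Fin n)
  (dV : Fin N → L) (hdV : ∀ i, IsCMField.complexConj L (dV i) = dV i)
  (dW : Fin M → L) (hdW : ∀ i, IsCMField.complexConj L (dW i) = dW i)

/-- `t_{w(σ)} k = Re σ_{w(σ)}(dV dW) = σ(t₀ k)` for the real place `σ` of `L⁺` below `w(σ) = cmPlaceOver L σ` (★ `realPlaceMap_eq_embedding_of_isReal`). [folklore] -/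
theorem re_embedding_cmPlaceOver_eq (σ : {v : InfinitePlace (Fp L) // v.IsReal}) (k : Fin n) :
    ((cmPlaceOver L σ).1.embedding (dV (e.symm k).1 * dW (e.symm k).2)).re = embedding_of_isReal σ.2 (cmGramEntry L e dV hdV dW hdW k) := by
  rw [← realPlaceMap_eq_embedding_of_isReal L (IsCMField.complexConj L) (cmPlaceOver L σ) (cmPlaceOver_smul L σ) (IsCMField.complexConj_ne_one L) σ
    (cmPlaceOver_comap L σ)]
  rfl

/-- **THE SIGN DICTIONARY**: at the real place `σ`, the doubled sign vector is positive at `e₂ p` iff `(p ∈ slot_{t_{w(σ)}} ⇔ 0 < deltaIm σ)` (`x(e₂ inl k) = t_k∕c_σ`,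
`x(e₂ inr k) = −t_k∕c_σ`; ★ `signVec_doubled_inl∕inr`). [cite: HarrisKudlaSweet1996, §1 (1.9)] [cite: KonnoKonno2007, §3.1] -/
theorem pos_signVec_e₂_iff (hdV0 : ∀ i, dV i ≠ 0) (hdW0 : ∀ j, dW j ≠ 0) (σ : {v : InfinitePlace (Fp L) // v.IsReal}) (p : Fin n ⊕ Fin n) :
    0 < signVec (cmPlaceOver L) (fun k => Sum.elim (cmGramEntry L e dV hdV dW hdW) (-cmGramEntry L e dV hdV dW hdW) ((UnitaryDualPair.LocalSplitting.e₂ n).symm k))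
        (imagUnit L) σ ((e₂ (n := n)) p) ↔
      (Sum.elim (fun k => 0 < ((cmPlaceOver L σ).1.embedding (dV (e.symm k).1 * dW (e.symm k).2)).re)
          (fun k => ¬0 < ((cmPlaceOver L σ).1.embedding (dV (e.symm k).1 * dW (e.symm k).2)).re) p ↔
        0 < deltaIm (cmPlaceOver L) (imagUnit L) σ) := by
  have hc : deltaIm (cmPlaceOver L) (imagUnit L) σ ≠ 0 :=
    deltaIm_ne_zero (IsCMField.complexConj_ne_one L) (cmPlaceOver_smul L) (complexConj_imagUnit L) (imagUnit_ne_zero L) σ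
  have ht : ∀ k, ((cmPlaceOver L σ).1.embedding (dV (e.symm k).1 * dW (e.symm k).2)).re ≠ 0 := fun k =>
    K2LiuHermitianTubeFrameArch.tw_ne_zero L e dV hdV dW hdW (cmPlaceOver L σ) (cmPlaceOver_smul L σ) hdV0 hdW0 k
  have hx : ∀ k, signVec (cmPlaceOver L) (cmGramEntry L e dV hdV dW hdW) (imagUnit L) σ k =
      ((cmPlaceOver L σ).1.embedding (dV (e.symm k).1 * dW (e.symm k).2)).re / deltaIm (cmPlaceOver L) (imagUnit L) σ := fun k => by
    rw [re_embedding_cmPlaceOver_eq]; rfl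
  -- sign bookkeeping for `a, b ≠ 0`: `0 < a∕b ⇔ (0 < a ⇔ 0 < b)` and `0 < −(a∕b) ⇔ (¬0 < a ⇔ 0 < b)` (cf. ★ `Landherr.div_pos_iff_of_ne_zero`)
  have key : ∀ {a b : ℝ}, a ≠ 0 → b ≠ 0 → (0 < a / b ↔ (0 < a ↔ 0 < b)) ∧ (0 < -(a / b) ↔ (¬0 < a ↔ 0 < b)) := by
    intro a b ha hb
    rcases lt_or_lt_iff_ne.2 ha with ha' | ha' <;> rcases lt_or_lt_iff_ne.2 hb with hb' | hb'
    · exact ⟨iff_of_true (div_pos_of_neg_of_neg ha' hb') (iff_of_false (not_lt.2 ha'.le) (not_lt.2 hb'.le)),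
        iff_of_false (not_lt.2 (neg_nonpos.2 (div_pos_of_neg_of_neg ha' hb').le)) (fun h => not_lt.2 hb'.le (h.1 (not_lt.2 ha'.le)))⟩
    · exact ⟨iff_of_false (not_lt.2 (div_neg_of_neg_of_pos ha' hb').le) (fun h => not_lt.2 ha'.le (h.2 hb')),
        iff_of_true (neg_pos.2 (div_neg_of_neg_of_pos ha' hb')) (iff_of_true (not_lt.2 ha'.le) hb')⟩
    · exact ⟨iff_of_false (not_lt.2 (div_neg_of_pos_of_neg ha' hb').le) (fun h => not_lt.2 hb'.le (h.1 ha')),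
        iff_of_true (neg_pos.2 (div_neg_of_pos_of_neg ha' hb')) (iff_of_false (not_not.2 ha') (not_lt.2 hb'.le))⟩
    · exact ⟨iff_of_true (div_pos ha' hb') (iff_of_true ha' hb'),
        iff_of_false (not_lt.2 (neg_nonpos.2 (div_pos ha' hb').le)) (fun h => (h.2 hb') ha')⟩
  rcases p with k | k
  · rw [signVec_doubled_inl, hx, Sum.elim_inl]
    exact (key (ht k) hc).1
  · rw [signVec_doubled_inr, hx, Sum.elim_inr]
    exact (key (ht k) hc).2

end Signs


/-! ## §3 The sign letter of the reading points -/

section Letter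

open Literature.NumberTheory.Automorphic Literature.NumberTheory.Automorphic.UnitaryGroup Literature.NumberTheory.Weil1964
open Literature.RepresentationTheory.KonnoKonno2007 Literature.RepresentationTheory.KonnoKonno2007.RealDualPair
open Literature.NumberTheory.GelbartRogawski1991 Literature.NumberTheory.GelbartRogawski1991.UnitaryDualPair
open Literature.NumberTheory.GelbartRogawski1991.GRConstruction

variable (L : Type) [Field L] [NumberField L] [IsCMField L] {N M n : ℕ} (e : Fin N × Fin M ≃ Fin n)
  (dV : Fin N → L) (hdV : ∀ i, IsCMField.complexConj L (dV i) = dV i)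
  (dW : Fin M → L) (hdW : ∀ i, IsCMField.complexConj L (dW i) = dW i)

/-- **THE SIGN LETTER OF THE READING POINTS.**  For reading frames `fr_w` with the ★ FILE 2 matrix formula (`u ↦ reindex e₂ (T_w⁻¹ κ(1,u) T_w)` on the explicit Shimura
frames), every `v : w ↦ U(n)` and every real place `σ` of `L⁺`: the sign-frame component at `σ` of the reading point `pt v = archPiEquivCM⁻¹ (w ↦ fr_w (v w))` is
SIGN-BLOCK COMPACT, `archUFormPi_𝔻 (pt v) σ = kV (α, β)`, with `(det α, det β) = (1, det v_{w(σ)})` when `0 < deltaIm σ` and `(det v_{w(σ)}, 1)` otherwise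
(★ FILE 1 §3 + §1–§2 + ★ `det_of_archUFormPi_eq_kV_of_sign_separated`). [cite: Folland1989, §4.2 Prop. (4.39)] [cite: KonnoKonno2007, §3.1 (3.1)] [cite: Shimura1997, §6.5] -/
theorem exists_kV_readingPoint (hdV0 : ∀ i, dV i ≠ 0) (hdW0 : ∀ j, dW j ≠ 0)
    (fr : ∀ w : {w : InfinitePlace L // w.IsComplex}, Matrix.unitaryGroup (Fin n) ℂ →* archLocal L (n + n) (hermD L e dV hdV dW hdW) w)
    (hfrM : ∀ (w : {w : InfinitePlace L // w.IsComplex}) (u : Matrix.unitaryGroup (Fin n) ℂ),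
      ((((fr w u : archLocal L (n + n) (hermD L e dV hdV dW hdW) w) : GL (Fin (n + n)) ℂ)) : Matrix (Fin (n + n)) (Fin (n + n)) ℂ) =
        Matrix.reindex (e₂ (n := n)) (e₂ (n := n))
          (fromBlocks (diagonal (fun k => (((Real.sqrt (|(w.1.embedding (dV (e.symm k).1 * dW (e.symm k).2)).re| / 2))⁻¹ / 2 : ℝ) : ℂ)))
              (-diagonal (fun k => I * (((Real.sqrt (|(w.1.embedding (dV (e.symm k).1 * dW (e.symm k).2)).re| / 2))⁻¹ *
                ((w.1.embedding (dV (e.symm k).1 * dW (e.symm k).2)).re / |(w.1.embedding (dV (e.symm k).1 * dW (e.symm k).2)).re|) / 2 : ℝ) : ℂ)))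
              (diagonal (fun k => (((Real.sqrt (|(w.1.embedding (dV (e.symm k).1 * dW (e.symm k).2)).re| / 2))⁻¹ / 2 : ℝ) : ℂ)))
              (diagonal (fun k => I * (((Real.sqrt (|(w.1.embedding (dV (e.symm k).1 * dW (e.symm k).2)).re| / 2))⁻¹ *
                ((w.1.embedding (dV (e.symm k).1 * dW (e.symm k).2)).re / |(w.1.embedding (dV (e.symm k).1 * dW (e.symm k).2)).re|) / 2 : ℝ) : ℂ))) *
            ((fromBlocks 1 1 (I • 1) (-(I • 1)) : Matrix (Fin n ⊕ Fin n) (Fin n ⊕ Fin n) ℂ) * fromBlocks 1 0 0 (u : Matrix (Fin n) (Fin n) ℂ) *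
              ((2 : ℂ)⁻¹ • fromBlocks 1 (-(I • 1)) 1 (I • 1))) *
            fromBlocks (diagonal (fun k => (Real.sqrt (|(w.1.embedding (dV (e.symm k).1 * dW (e.symm k).2)).re| / 2) : ℂ)))
              (diagonal (fun k => (Real.sqrt (|(w.1.embedding (dV (e.symm k).1 * dW (e.symm k).2)).re| / 2) : ℂ)))
              (diagonal (fun k => I * ((((w.1.embedding (dV (e.symm k).1 * dW (e.symm k).2)).re / |(w.1.embedding (dV (e.symm k).1 * dW (e.symm k).2)).re|) *
                Real.sqrt (|(w.1.embedding (dV (e.symm k).1 * dW (e.symm k).2)).re| / 2) : ℝ) : ℂ)))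
              (-diagonal (fun k => I * ((((w.1.embedding (dV (e.symm k).1 * dW (e.symm k).2)).re / |(w.1.embedding (dV (e.symm k).1 * dW (e.symm k).2)).re|) *
                Real.sqrt (|(w.1.embedding (dV (e.symm k).1 * dW (e.symm k).2)).re| / 2) : ℝ) : ℂ)))))
    (v : {w : InfinitePlace L // w.IsComplex} → Matrix.unitaryGroup (Fin n) ℂ) (σ : {v : InfinitePlace (Fp L) // v.IsReal}) :
    ∃ k : Matrix.unitaryGroup (PosIdx (signVec (cmPlaceOver L)
        (fun k => Sum.elim (cmGramEntry L e dV hdV dW hdW) (-cmGramEntry L e dV hdV dW hdW) ((UnitaryDualPair.LocalSplitting.e₂ n).symm k)) (imagUnit L) σ)) ℂ ×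
      Matrix.unitaryGroup (NegIdx (signVec (cmPlaceOver L)
        (fun k => Sum.elim (cmGramEntry L e dV hdV dW hdW) (-cmGramEntry L e dV hdV dW hdW) ((UnitaryDualPair.LocalSplitting.e₂ n).symm k)) (imagUnit L) σ)) ℂ,
      archUFormPi L (IsCMField.complexConj L) (n + n) (IsCMField.complexConj_ne_one L) (cmPlaceOver L) (cmPlaceOver_smul L) (cmPlaceOver_comap L) _
          (gramD_gram_realDiagonal_entry_ne_zero L e dV hdV dW hdW hdV0 hdW0) (gramD_eq_diagonal_cm L e dV hdV dW hdW) (J := hermD L e dV hdV dW hdW) rfl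
          (complexConj_imagUnit L) (imagUnit_ne_zero L)
          ((archPiEquivCM (n + n) L (hermD L e dV hdV dW hdW)).symm fun w => fr w (v w)) σ = UForm.kV _ _ k ∧
      k.1.1.det = (if 0 < deltaIm (cmPlaceOver L) (imagUnit L) σ then 1
        else ((v (cmPlaceOver L σ) : Matrix.unitaryGroup (Fin n) ℂ) : Matrix (Fin n) (Fin n) ℂ).det) ∧
      k.2.1.det = (if 0 < deltaIm (cmPlaceOver L) (imagUnit L) σ
        then ((v (cmPlaceOver L σ) : Matrix.unitaryGroup (Fin n) ℂ) : Matrix (Fin n) (Fin n) ℂ).det else 1) := by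
  have hw : IsCMField.complexConj L • (cmPlaceOver L σ).1 = (cmPlaceOver L σ).1 := cmPlaceOver_smul L σ
  have ht : ∀ k, ((cmPlaceOver L σ).1.embedding (dV (e.symm k).1 * dW (e.symm k).2)).re ≠ 0 := K2LiuHermitianTubeFrameArch.tw_ne_zero L e dV hdV dW hdW (cmPlaceOver L σ) hw hdV0 hdW0
  -- the place component at `w(σ)` of the reading point is the sorted matrix (★ FILE 2 + ★ FILE 1 §3)
  have hA : (((archAt (Fp L) L (IsCMField.complexConj L) (n + n) (hermD L e dV hdV dW hdW) (cmPlaceOver L σ) (cmPlaceOver_smul L σ)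
        (IsCMField.complexConj_ne_one L) ((archPiEquivCM (n + n) L (hermD L e dV hdV dW hdW)).symm fun w => fr w (v w)) :
        archLocal L (n + n) (hermD L e dV hdV dW hdW) (cmPlaceOver L σ)) : GL (Fin (n + n)) ℂ) : Matrix (Fin (n + n)) (Fin (n + n)) ℂ) =
      Matrix.reindex (e₂ (n := n)) (e₂ (n := n)) (fromBlocks
        (Matrix.of fun i j => ((Real.sqrt (|((cmPlaceOver L σ).1.embedding (dV (e.symm j).1 * dW (e.symm j).2)).re| / 2) / Real.sqrt (|((cmPlaceOver L σ).1.embedding (dV (e.symm i).1 * dW (e.symm i).2)).re| / 2) : ℝ) : ℂ) *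
          (if 0 < ((cmPlaceOver L σ).1.embedding (dV (e.symm i).1 * dW (e.symm i).2)).re then (if 0 < ((cmPlaceOver L σ).1.embedding (dV (e.symm j).1 * dW (e.symm j).2)).re then (1 : Matrix (Fin n) (Fin n) ℂ) i j else 0)
            else (if 0 < ((cmPlaceOver L σ).1.embedding (dV (e.symm j).1 * dW (e.symm j).2)).re then 0 else ((v (cmPlaceOver L σ) : Matrix.unitaryGroup (Fin n) ℂ) : Matrix (Fin n) (Fin n) ℂ) i j)))
        (Matrix.of fun i j => ((Real.sqrt (|((cmPlaceOver L σ).1.embedding (dV (e.symm j).1 * dW (e.symm j).2)).re| / 2) / Real.sqrt (|((cmPlaceOver L σ).1.embedding (dV (e.symm i).1 * dW (e.symm i).2)).re| / 2) : ℝ) : ℂ) *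
          (if 0 < ((cmPlaceOver L σ).1.embedding (dV (e.symm i).1 * dW (e.symm i).2)).re then (if 0 < ((cmPlaceOver L σ).1.embedding (dV (e.symm j).1 * dW (e.symm j).2)).re then 0 else (1 : Matrix (Fin n) (Fin n) ℂ) i j)
            else (if 0 < ((cmPlaceOver L σ).1.embedding (dV (e.symm j).1 * dW (e.symm j).2)).re then ((v (cmPlaceOver L σ) : Matrix.unitaryGroup (Fin n) ℂ) : Matrix (Fin n) (Fin n) ℂ) i j else 0)))
        (Matrix.of fun i j => ((Real.sqrt (|((cmPlaceOver L σ).1.embedding (dV (e.symm j).1 * dW (e.symm j).2)).re| / 2) / Real.sqrt (|((cmPlaceOver L σ).1.embedding (dV (e.symm i).1 * dW (e.symm i).2)).re| / 2) : ℝ) : ℂ) *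
          (if 0 < ((cmPlaceOver L σ).1.embedding (dV (e.symm i).1 * dW (e.symm i).2)).re then (if 0 < ((cmPlaceOver L σ).1.embedding (dV (e.symm j).1 * dW (e.symm j).2)).re then 0 else ((v (cmPlaceOver L σ) : Matrix.unitaryGroup (Fin n) ℂ) : Matrix (Fin n) (Fin n) ℂ) i j)
            else (if 0 < ((cmPlaceOver L σ).1.embedding (dV (e.symm j).1 * dW (e.symm j).2)).re then (1 : Matrix (Fin n) (Fin n) ℂ) i j else 0)))
        (Matrix.of fun i j => ((Real.sqrt (|((cmPlaceOver L σ).1.embedding (dV (e.symm j).1 * dW (e.symm j).2)).re| / 2) / Real.sqrt (|((cmPlaceOver L σ).1.embedding (dV (e.symm i).1 * dW (e.symm i).2)).re| / 2) : ℝ) : ℂ) *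
          (if 0 < ((cmPlaceOver L σ).1.embedding (dV (e.symm i).1 * dW (e.symm i).2)).re then (if 0 < ((cmPlaceOver L σ).1.embedding (dV (e.symm j).1 * dW (e.symm j).2)).re then ((v (cmPlaceOver L σ) : Matrix.unitaryGroup (Fin n) ℂ) : Matrix (Fin n) (Fin n) ℂ) i j else 0)
            else (if 0 < ((cmPlaceOver L σ).1.embedding (dV (e.symm j).1 * dW (e.symm j).2)).re then 0 else (1 : Matrix (Fin n) (Fin n) ℂ) i j)))) := by
    rw [K2LiuArchReadingFrame.archAt_archPiEquivCM_symm, hfrM,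
      K2LiuHermitianTubeFrameSign.frameInv_kappa_frame (fun k => ((cmPlaceOver L σ).1.embedding (dV (e.symm k).1 * dW (e.symm k).2)).re) ht]
  -- the sign dictionary (§2) and non-vanishing of `c_σ`
  have hsgn := pos_signVec_e₂_iff L e dV hdV dW hdW hdV0 hdW0 σ
  -- sign separation of the place component (§1 `sorted_apply`)
  obtain ⟨k, hk, h1, h2⟩ := det_of_archUFormPi_eq_kV_of_sign_separated L (IsCMField.complexConj L) (n + n) (IsCMField.complexConj_ne_one L) (cmPlaceOver L)
    (cmPlaceOver_smul L) (cmPlaceOver_comap L) _ (gramD_gram_realDiagonal_entry_ne_zero L e dV hdV dW hdW hdV0 hdW0) (gramD_eq_diagonal_cm L e dV hdV dW hdW)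
    (J := hermD L e dV hdV dW hdW) rfl (complexConj_imagUnit L) (imagUnit_ne_zero L)
    ((archPiEquivCM (n + n) L (hermD L e dV hdV dW hdW)).symm fun w => fr w (v w)) σ (by
      intro i j hi hj
      obtain ⟨p, rfl⟩ := (e₂ (n := n)).surjective i
      obtain ⟨q, rfl⟩ := (e₂ (n := n)).surjective j
      rw [hsgn] at hi hj
      have hpq : ¬ (Sum.elim (fun k => 0 < ((cmPlaceOver L σ).1.embedding (dV (e.symm k).1 * dW (e.symm k).2)).re) (fun k => ¬0 < ((cmPlaceOver L σ).1.embedding (dV (e.symm k).1 * dW (e.symm k).2)).re) p ↔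
          Sum.elim (fun k => 0 < ((cmPlaceOver L σ).1.embedding (dV (e.symm k).1 * dW (e.symm k).2)).re) (fun k => ¬0 < ((cmPlaceOver L σ).1.embedding (dV (e.symm k).1 * dW (e.symm k).2)).re) q) := fun h => hj (h.symm.trans hi)
      have hqp : ¬ (Sum.elim (fun k => 0 < ((cmPlaceOver L σ).1.embedding (dV (e.symm k).1 * dW (e.symm k).2)).re) (fun k => ¬0 < ((cmPlaceOver L σ).1.embedding (dV (e.symm k).1 * dW (e.symm k).2)).re) q ↔
          Sum.elim (fun k => 0 < ((cmPlaceOver L σ).1.embedding (dV (e.symm k).1 * dW (e.symm k).2)).re) (fun k => ¬0 < ((cmPlaceOver L σ).1.embedding (dV (e.symm k).1 * dW (e.symm k).2)).re) p) := fun h => hpq h.symm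
      rw [hA, reindex_apply, submatrix_apply, submatrix_apply, Equiv.symm_apply_apply, Equiv.symm_apply_apply,
        sorted_apply _ ht _ p q, if_neg hpq, sorted_apply _ ht _ q p, if_neg hqp]
      exact ⟨rfl, rfl⟩)
  refine ⟨k, hk, ?_, ?_⟩
  · -- the positive block: on the slot (`0 < c_σ`) or on the co-slot (`c_σ < 0`)
    rw [h1, hA, reindex_apply, submatrix_submatrix]
    by_cases hc : 0 < deltaIm (cmPlaceOver L) (imagUnit L) σ
    · rw [if_pos hc, submatrix_sorted_eq_one _ ht _ _ ((e₂ (n := n)).symm.injective.comp Subtype.val_injective)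
        (fun s => by have h := s.2; rw [← (e₂ (n := n)).apply_symm_apply s.1, hsgn] at h; exact h.2 hc), det_one]
    · rw [if_neg hc]
      refine det_submatrix_sorted_eq_det _ ht _ _ ((e₂ (n := n)).symm.injective.comp Subtype.val_injective)
        (fun s => by have h := s.2; rw [← (e₂ (n := n)).apply_symm_apply s.1, hsgn] at h; exact fun hs => hc (h.1 hs)) (fun k => ?_)
      by_cases hk0 : 0 < ((cmPlaceOver L σ).1.embedding (dV (e.symm k).1 * dW (e.symm k).2)).re
      · refine ⟨⟨e₂ (n := n) (Sum.inr k), (hsgn _).2 (iff_of_false (not_not.2 hk0) hc)⟩, ?_⟩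
        simp only [Function.comp_apply, Equiv.symm_apply_apply, Sum.elim_inr, id]
      · refine ⟨⟨e₂ (n := n) (Sum.inl k), (hsgn _).2 (iff_of_false hk0 hc)⟩, ?_⟩
        simp only [Function.comp_apply, Equiv.symm_apply_apply, Sum.elim_inl, id]
  · -- the negative block: the other way round
    rw [h2, hA, reindex_apply, submatrix_submatrix]
    by_cases hc : 0 < deltaIm (cmPlaceOver L) (imagUnit L) σ
    · rw [if_pos hc]
      refine det_submatrix_sorted_eq_det _ ht _ _ ((e₂ (n := n)).symm.injective.comp Subtype.val_injective)
        (fun s => by have h := s.2; rw [← (e₂ (n := n)).apply_symm_apply s.1, hsgn] at h; exact fun hs => h (iff_of_true hs hc)) (fun k => ?_)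
      by_cases hk0 : 0 < ((cmPlaceOver L σ).1.embedding (dV (e.symm k).1 * dW (e.symm k).2)).re
      · refine ⟨⟨e₂ (n := n) (Sum.inr k), fun h' => absurd hk0 (((hsgn _).1 h').2 hc)⟩, ?_⟩
        simp only [Function.comp_apply, Equiv.symm_apply_apply, Sum.elim_inr, id]
      · refine ⟨⟨e₂ (n := n) (Sum.inl k), fun h' => hk0 (((hsgn _).1 h').2 hc)⟩, ?_⟩
        simp only [Function.comp_apply, Equiv.symm_apply_apply, Sum.elim_inl, id]
    · rw [if_neg hc, submatrix_sorted_eq_one _ ht _ _ ((e₂ (n := n)).symm.injective.comp Subtype.val_injective)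
        (fun s => by
          have h := s.2
          rw [← (e₂ (n := n)).apply_symm_apply s.1, hsgn] at h
          by_contra hs
          exact h (iff_of_false hs hc)), det_one]

end Letter

end Summit.HodgeConjecture.HodgeConjecture.Cruxes.HLiu418.K2LiuArchReadingFrameSign

end
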